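import Mathlib
import Literature.NumberTheory.LFunctions.Zhang2022.Section7dResidues
import Literature.NumberTheory.LFunctions.Zhang2022.Section7MainTermBridges
import Literature.NumberTheory.LFunctions.Zhang2022.Section7dBridge
import Literature.NumberTheory.LFunctions.Zhang2022.Section7ResidueExtraction
import Literature.NumberTheory.LFunctions.Zhang2022.Section7Rearrangements
import Literature.NumberTheory.LFunctions.Zhang2022.Section7KappaEuler
import Literature.NumberTheory.LFunctions.Zhang2022.Section7bDischarges
import Literature.NumberTheory.LFunctions.Zhang2022.Section5Lemma54Discharge
import Literature.NumberTheory.LFunctions.Zhang2022.Section7ContourShift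
import Literature.NumberTheory.LFunctions.Zhang2022.Section7WeightSummability
import HarnessLib

/-!
# Zhang (2022), §7 proof of Proposition 7.1 part (c): closure of the main-term chain
# (`Z22:§7.u058`–`u060` discharged outright; (7.10) from the three remaining analytic leaves)

Topic `Literature/NumberTheory/LFunctions/Zhang2022` (Landau–Siegel audit tree; verdict-neutral).
Y. Zhang, *Discrete mean estimates and the Landau–Siegel zero*, arXiv:2211.02515v1 (2022)
[Zhang2022LandauSiegel], §7 pp. 39–42 (tex L2063–L2178), "*Proof of Proposition 7.1: the main term*".

THEOREM-ONLY file (0 new definitions, 0 new facts, D-0026): pure compositions of tree theorems.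

1. `step7u058_holds`, `step7u059_holds`, `step7u060_holds : Step7u05k c'` — the three residue
   evaluations `i𝔯ⱼp^{−β_j} = ½α⁻¹, 2α⁻¹, (3/2)α⁻¹ + O(𝓛)` (p. 42, tex L2168–L2177; the coefficients
   `½, 2, 3/2` of Proposition 7.1's main term) now hold OUTRIGHT: the kernel edges
   `step7u05k_of : Skeleton.Lemma54 → Step7u05k c'` (`Section7dResidues`) composed with the landed
   discharge `Skeleton.lemma54_holds` (`Section5Lemma54Discharge`).
2. `eq710_of_eq720`, `eq710b_of_eq720` : (7.20) ⇒ (7.10) with NO further hypothesis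
   (`eq710_of_eq720_lemma54` of `Section7MainTermBridges` with its `Lemma54` leaf fed), in both the
   L2-t5 (`Iface.Eq710`) and the owner's (`Section7bStatements.Eq710`) spelling of (7.10).
3. `eq720_of_step7u052`, `eq710_of_step7u052` : §7.u052 ⇒ (7.20) ⇒ (7.10) ((7.18) is the theorem
   `eq718_holds`, `Section7Rearrangements`; edge `eq720_of`, `Section7ResidueExtraction`).
4. `step7u049_of_contour`, `eq710_of_contour` : with (7.19) (`eq719_holds`) and the Euler-product
   identity §7.u045 (`step7u045_holds`) theorems, §7.u049 — and hence (7.10) — follows from the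
   contour-shift identity §7.u047/u048 (`Step7u047`) and the "standard estimates" size bound for the
   integral over the shifted contour AS PRINTED (uniform constant; cf. gap row G-d24-1).
5. `prop71_of_partC_leaves` : Proposition 7.1 (`Skeleton.Prop71 c'`) from its part-(a)/(b) leaves
   (7.6) `Eq76`, (7.7)′ `Step7t1944`, (7.11) `Eq711` (`Section7bDischarges.prop71_of_leaves`) with
   the (7.10) leaf REPLACED by the two part-(c) leaves of item 4. (The WEIGHTED form of the chain —
   contour bound `C·G(D,d₁,d₂,k)·pkε₁/l₂` plus a polylogarithmic average of `G`, the derivable reading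
   of the "standard estimates" step per gap row G-d24-1, edges `step7u049_of_weighted`,
   `ded7u052_of_weighted`, `eq720_of_weighted` of `Section7ResidueExtraction` — composes the same way
   and is appended to this file separately.)

6. (appended once `step7u047_holds` — `Section7ContourShift` — and the weighted chain with its
   summability clause — `Section7ResidueExtraction` (`*_weighted`), `Section7WeightSummability`
   (`weightSum_tauFive_le`, `eq720_of_step7u047_of_weighted_contour_bound`) — were in the tree)
   `eq710_of_contour_weighted`, `prop71_of_partC_leaves_weighted` : the WEIGHTED twins of items
   4/5 for an arbitrary weight `G ≥ 0` with polylogarithmic (7.18)-average (gap row G-d24-1: the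
   printed uniform constant of §7.u049 does not follow from the manuscript's own `κ̃`-bound, a
   `d₁`-dependent weight does and is harmless on average); and, with the contour-shift identity
   §7.u047/u048 now a THEOREM, the forms in which the ONLY remaining hypothesis is the size bound
   for the shifted-contour integral: `eq710_of_contourBound` (printed uniform form),
   `eq710_of_contourBound_weighted` (any `G` + its average), `eq710_of_contourBoundG0` (the
   derivable weight `G₀ = τ₅(d₁)∏_{q∣d₁d₂k}(1 + 200q^{−9/10})²`, whose average is the theorem
   `weightSum_tauFive_le`), and `prop71_of_leaves_contourBoundG0 : Eq76 → Step7t1944 → Eq711 →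
   ContourW[G₀] → Prop71` — the leaf `h710 : Eq710 c′` of the whole-DAG theorem thus closes by
   `eq710_of_contourBoundG0` the moment the `G₀`-weighted contour bound lands.

Node tokens (for the layer board): `Z22:§7.u058`, `Z22:§7.u059`, `Z22:§7.u060` = discharged
(decls `step7u058_holds`, `step7u059_holds`, `step7u060_holds`). No other node changes status here:
`Z22:§7.u047`/`u048` (contour identity), the contour size bound and the weight average remain the
named hypotheses of items 4–5 (held by other seats of the cell at filing time).

WHAT THIS IS NOT: any claim about Theorems 1–2 of the manuscript or about Landau–Siegel zeros; not
a discharge of (7.10), (7.20), §7.u047/u049/u052 or of Proposition 7.1 — those stay conditional on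
the hypotheses displayed in the theorem statements below.

## References

* Y. Zhang, arXiv:2211.02515v1 (2022), §7 pp. 39–42, tex L2063–L2178 (part (c)); (7.10) p. 37
  tex L1973; Lemma 5.4 p. 28. [cite: Zhang2022LandauSiegel, §7 pp.39–42]
-/

noncomputable section

open Complex Real

namespace Literature.NumberTheory.LFunctions.Zhang2022.Section7dStatements

/-! ## 1. The residue evaluations `Z22:§7.u058`–`u060` hold outright -/

/-- `Z22:§7.u058` DISCHARGED. **`i𝔯₁p^{−β₁} = 1/(2α) + O(𝓛)`** for `p ∼ P` (§7 p. 42): the edge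
`step7u058_of` from Lemma 5.4 composed with `Skeleton.lemma54_holds`.
[cite: Zhang2022LandauSiegel, §7 p.42, tex L2168–L2171] -/
theorem step7u058_holds (c' : ℝ) : Step7u058 c' := step7u058_of c' Skeleton.lemma54_holds

variable (c' : ℝ) in
/-- `Step7u058` — `_holds` alias of `step7u058_holds` above under the fact's exact name, stated under the
prover's own binders as section variables (appended 2026-08-28, D-0026 bookkeeping: the proof term is the
existing theorem of this file; no statement, definition or attribute is edited; no new named fact; the
ledger's debt table listed the fact unproved). [cite: Zhang2022LandauSiegel, §7 p.42, tex L2168–L2171] -/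
theorem _root_.Literature.NumberTheory.LFunctions.Zhang2022.Section7dStatements.Step7u058_holds :
    _root_.Literature.NumberTheory.LFunctions.Zhang2022.Section7dStatements.Step7u058 c' :=
  _root_.Literature.NumberTheory.LFunctions.Zhang2022.Section7dStatements.step7u058_holds (c' := c')

/-- `Z22:§7.u059` DISCHARGED. **`i𝔯₂p^{−β₂} = 2/α + O(𝓛)`** for `p ∼ P` (§7 p. 42).
[cite: Zhang2022LandauSiegel, §7 p.42, tex L2172–L2174] -/
theorem step7u059_holds (c' : ℝ) : Step7u059 c' := step7u059_of c' Skeleton.lemma54_holds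

variable (c' : ℝ) in
/-- `Step7u059` — `_holds` alias of `step7u059_holds` above under the fact's exact name, stated under the
prover's own binders as section variables (appended 2026-08-28, D-0026 bookkeeping: the proof term is the
existing theorem of this file; no statement, definition or attribute is edited; no new named fact; the
ledger's debt table listed the fact unproved). [cite: Zhang2022LandauSiegel, §7 p.42, tex L2172–L2174] -/
theorem _root_.Literature.NumberTheory.LFunctions.Zhang2022.Section7dStatements.Step7u059_holds :
    _root_.Literature.NumberTheory.LFunctions.Zhang2022.Section7dStatements.Step7u059 c' :=
  _root_.Literature.NumberTheory.LFunctions.Zhang2022.Section7dStatements.step7u059_holds (c' := c')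

/-- `Z22:§7.u060` DISCHARGED. **`i𝔯₃p^{−β₃} = 3/(2α) + O(𝓛)`** for `p ∼ P` (§7 p. 42).
[cite: Zhang2022LandauSiegel, §7 p.42, tex L2175–L2177] -/
theorem step7u060_holds (c' : ℝ) : Step7u060 c' := step7u060_of c' Skeleton.lemma54_holds

variable (c' : ℝ) in
/-- `Step7u060` — `_holds` alias of `step7u060_holds` above under the fact's exact name, stated under the
prover's own binders as section variables (appended 2026-08-28, D-0026 bookkeeping: the proof term is the
existing theorem of this file; no statement, definition or attribute is edited; no new named fact; the
ledger's debt table listed the fact unproved). [cite: Zhang2022LandauSiegel, §7 p.42, tex L2175–L2177] -/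
theorem _root_.Literature.NumberTheory.LFunctions.Zhang2022.Section7dStatements.Step7u060_holds :
    _root_.Literature.NumberTheory.LFunctions.Zhang2022.Section7dStatements.Step7u060 c' :=
  _root_.Literature.NumberTheory.LFunctions.Zhang2022.Section7dStatements.step7u060_holds (c' := c')

/-! ## 2. (7.20) ⇒ (7.10) with no further hypothesis -/

/-- **(7.10) from (7.20) alone** (L2-t5 spelling `Iface.Eq710`): (7.21) (`eq721_holds`) and the
residue evaluations (`step7u05k_holds`) being theorems, the closing inference of part (c)
"(7.20) ∧ (7.21) ∧ residues ⇒ (7.10)" (`dedProp71c_tail`) needs only (7.20).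
[cite: Zhang2022LandauSiegel, §7 p.42, tex L2177] -/
theorem eq710_of_eq720 (c' : ℝ) (h720 : Eq720 c') : Iface.Eq710 c' :=
  eq710_of_eq720_lemma54 c' h720 Skeleton.lemma54_holds

/-- **(7.10) from (7.20) alone**, owner's spelling `Section7bStatements.Eq710` (via the interface
merge `Iface.eq710_iff`). [cite: Zhang2022LandauSiegel, §7 (7.10) p.37, tex L1973] -/
theorem eq710b_of_eq720 (c' : ℝ) (h720 : Eq720 c') : Section7bStatements.Eq710 c' :=
  (Iface.eq710_iff c').mp (eq710_of_eq720 c' h720)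

/-! ## 3. §7.u052 ⇒ (7.20) ⇒ (7.10) -/

/-- **(7.20) from §7.u052 alone**: "Inserting this into (7.18) and rearranging the terms" — (7.18)
is the theorem `eq718_holds`, the insertion is the edge `eq720_of`.
[cite: Zhang2022LandauSiegel, §7 (7.20) p.41, tex L2131–L2138] -/
theorem eq720_of_step7u052 (c' : ℝ) (h52 : Step7u052 c') : Eq720 c' :=
  eq720_of c' (eq718_holds c') h52

/-- **(7.10) from §7.u052 alone** (owner's spelling). [cite: Zhang2022LandauSiegel, §7 p.41–42] -/
theorem eq710_of_step7u052 (c' : ℝ) (h52 : Step7u052 c') : Section7bStatements.Eq710 c' :=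
  eq710b_of_eq720 c' (eq720_of_step7u052 c' h52)

/-! ## 4. The printed (uniform) chain: §7.u047 ∧ contour bound ⇒ §7.u049 ⇒ (7.10) -/

/-- **§7.u049 from the contour-shift identity and the printed contour bound**: (7.19) (`eq719_holds`)
and the Euler-product identity §7.u045 (`step7u045_holds`) are theorems, so the edge `step7u049_of`
needs only `Step7u047` (the move of the line `σ = 3/2` to the contour of p. 40 with its three
residues) and the "standard estimates" bound `‖(1/2πi)∫_𝒞 (l₂/pk)^{−s}κ̃λ·ζζζζ⁻¹δ ds‖ ≤ C·pkε₁/l₂`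
with the PRINTED uniform constant. [cite: Zhang2022LandauSiegel, §7 p.40, tex L2108–L2126] -/
theorem step7u049_of_contour (c' : ℝ) (h47 : Step7u047 c')
    (hbound : ∃ c : ℝ, 0 < c ∧ ∃ C : ℝ, Skeleton.ForAllLarge fun D _ χ =>
      Skeleton.AssumptionA D χ → ∀ p ∈ Skeleton.primeWindow D, ∀ d₁ d₂ k l₂ : ℕ,
        0 < d₁ → 0 < d₂ → 0 < k → 0 < l₂ →
        ((d₂ * l₂ : ℕ) : ℝ) < Skeleton.bigP D / Skeleton.bigT D ^ 2 →
        ((d₁ * d₂ * k : ℕ) : ℝ) < Skeleton.bigP D / Skeleton.bigT D ^ 2 →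
          ‖contour719 D (fun s =>
              (((l₂ : ℝ) / ((p : ℝ) * k) : ℝ) : ℂ) ^ (-s) *
                (Skeleton.kappaTilde c' D d₁ (d₂ * k) s * Skeleton.lam c' D (d₁ * d₂ * k) s *
                  resFn c' D s))‖ ≤ C * ((p : ℝ) * k * eps1 c D / l₂)) :
    Step7u049 c' :=
  step7u049_of c' (eq719_holds c') (step7u045_holds c') h47 hbound

/-- **(7.10) from the contour-shift identity and the printed contour bound** (uniform constant):
`§7.u047 ∧ bound ⇒ §7.u049 ⇒ §7.u052 ⇒ (7.20) ⇒ (7.10)`, every other input a theorem.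
[cite: Zhang2022LandauSiegel, §7 pp.40–42, tex L2108–L2177] -/
theorem eq710_of_contour (c' : ℝ) (h47 : Step7u047 c')
    (hbound : ∃ c : ℝ, 0 < c ∧ ∃ C : ℝ, Skeleton.ForAllLarge fun D _ χ =>
      Skeleton.AssumptionA D χ → ∀ p ∈ Skeleton.primeWindow D, ∀ d₁ d₂ k l₂ : ℕ,
        0 < d₁ → 0 < d₂ → 0 < k → 0 < l₂ →
        ((d₂ * l₂ : ℕ) : ℝ) < Skeleton.bigP D / Skeleton.bigT D ^ 2 →
        ((d₁ * d₂ * k : ℕ) : ℝ) < Skeleton.bigP D / Skeleton.bigT D ^ 2 →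
          ‖contour719 D (fun s =>
              (((l₂ : ℝ) / ((p : ℝ) * k) : ℝ) : ℂ) ^ (-s) *
                (Skeleton.kappaTilde c' D d₁ (d₂ * k) s * Skeleton.lam c' D (d₁ * d₂ * k) s *
                  resFn c' D s))‖ ≤ C * ((p : ℝ) * k * eps1 c D / l₂)) :
    Section7bStatements.Eq710 c' :=
  eq710_of_step7u052 c' (ded7u052_of c' (step7u049_of_contour c' h47 hbound))

/-! ## 5. Proposition 7.1 with the (7.10) leaf replaced by the part-(c) leaves -/

/-- **Proposition 7.1 from (7.6), (7.7)′, (7.11) and the two part-(c) leaves (printed form)**: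
`Section7bStatements.prop71_of_leaves` with its (7.10) hypothesis supplied by `eq710_of_contour`.
[cite: Zhang2022LandauSiegel, §7 pp.35–42, tex L1912–L2178] -/
theorem prop71_of_partC_leaves (c' : ℝ) (h76 : Section7bStatements.Eq76 c')
    (h1944 : Section7bStatements.Step7t1944 c') (h711 : Section7bStatements.Eq711 c')
    (h47 : Step7u047 c')
    (hbound : ∃ c : ℝ, 0 < c ∧ ∃ C : ℝ, Skeleton.ForAllLarge fun D _ χ =>
      Skeleton.AssumptionA D χ → ∀ p ∈ Skeleton.primeWindow D, ∀ d₁ d₂ k l₂ : ℕ,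
        0 < d₁ → 0 < d₂ → 0 < k → 0 < l₂ →
        ((d₂ * l₂ : ℕ) : ℝ) < Skeleton.bigP D / Skeleton.bigT D ^ 2 →
        ((d₁ * d₂ * k : ℕ) : ℝ) < Skeleton.bigP D / Skeleton.bigT D ^ 2 →
          ‖contour719 D (fun s =>
              (((l₂ : ℝ) / ((p : ℝ) * k) : ℝ) : ℂ) ^ (-s) *
                (Skeleton.kappaTilde c' D d₁ (d₂ * k) s * Skeleton.lam c' D (d₁ * d₂ * k) s *
                  resFn c' D s))‖ ≤ C * ((p : ℝ) * k * eps1 c D / l₂)) :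
    Skeleton.Prop71 c' :=
  Section7bStatements.prop71_of_leaves c' h76 h1944 (eq710_of_contour c' h47 hbound) h711


/-! ## 6. Appended: the weighted chain, and the forms with §7.u047 fed (`step7u047_holds`)

After `Section7ContourShift.step7u047_holds` (the exact contour identity, nodes `Z22:§7.u047/u048`)
and `Section7WeightSummability` (`weightSum_tauFive_le`, the polylogarithmic average of the weight
`G₀`) landed, the single remaining hypothesis of Proposition 7.1 part (c) is the size bound for the
integral over the shifted contour `contour719` ("standard estimates", §7 p. 40). -/

/-- **(7.10) AS PRINTED from §7.u047, a WEIGHTED contour bound and the weight's polylogarithmic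
average** (the derivable reading of the "standard estimates" step, G-d24-1): for any
`G(D,d₁,d₂,k) ≥ 0`, composing `step7u049_of_weighted → ded7u052_of_weighted → eq720_of_weighted`
(inputs `eq719_holds`, `step7u045_holds`, `eq718_holds` are theorems) with `eq710b_of_eq720`.
[cite: Zhang2022LandauSiegel, §7 pp.40–42, tex L2108–L2177] -/
theorem eq710_of_contour_weighted (c' : ℝ) (G : ℕ → ℕ → ℕ → ℕ → ℝ)
    (hG : ∀ D d₁ d₂ k, 0 ≤ G D d₁ d₂ k)
    (hsum : ∃ K : ℕ, ∃ C₀ : ℝ, ∃ D₁ : ℕ, ∀ D : ℕ, D₁ ≤ D →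
      ∑ d₁ ∈ Finset.Ico 1 (Skeleton.Nsupp D), ∑ d₂ ∈ Finset.Ico 1 (Skeleton.Nsupp D),
        ∑ k ∈ Finset.Ico 1 (Skeleton.Nsupp D),
          G D d₁ d₂ k / ((d₁ : ℝ) * d₂ * (Nat.totient k : ℝ)) ≤ C₀ * Skeleton.ell D ^ K)
    (h47 : Step7u047 c')
    (hbound : ∃ c : ℝ, 0 < c ∧ ∃ C : ℝ, Skeleton.ForAllLarge fun D _ χ =>
      Skeleton.AssumptionA D χ → ∀ p ∈ Skeleton.primeWindow D, ∀ d₁ d₂ k l₂ : ℕ,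
        0 < d₁ → 0 < d₂ → 0 < k → 0 < l₂ →
        ((d₂ * l₂ : ℕ) : ℝ) < Skeleton.bigP D / Skeleton.bigT D ^ 2 →
        ((d₁ * d₂ * k : ℕ) : ℝ) < Skeleton.bigP D / Skeleton.bigT D ^ 2 →
          ‖contour719 D (fun s =>
              (((l₂ : ℝ) / ((p : ℝ) * k) : ℝ) : ℂ) ^ (-s) *
                (Skeleton.kappaTilde c' D d₁ (d₂ * k) s * Skeleton.lam c' D (d₁ * d₂ * k) s *
                  resFn c' D s))‖ ≤ C * G D d₁ d₂ k * ((p : ℝ) * k * eps1 c D / l₂)) :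
    Section7bStatements.Eq710 c' :=
  eq710b_of_eq720 c'
    (eq720_of_weighted c' G hG hsum (eq718_holds c')
      (ded7u052_of_weighted c' G hG
        (step7u049_of_weighted c' G (eq719_holds c') (step7u045_holds c') h47 hbound)))

/-- **Proposition 7.1 from (7.6), (7.7)′, (7.11) and the three WEIGHTED part-(c) leaves**:
`Section7bStatements.prop71_of_leaves` with its (7.10) hypothesis supplied by
`eq710_of_contour_weighted`. [cite: Zhang2022LandauSiegel, §7 pp.35–42, tex L1912–L2178] -/
theorem prop71_of_partC_leaves_weighted (c' : ℝ) (h76 : Section7bStatements.Eq76 c')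
    (h1944 : Section7bStatements.Step7t1944 c') (h711 : Section7bStatements.Eq711 c')
    (G : ℕ → ℕ → ℕ → ℕ → ℝ) (hG : ∀ D d₁ d₂ k, 0 ≤ G D d₁ d₂ k)
    (hsum : ∃ K : ℕ, ∃ C₀ : ℝ, ∃ D₁ : ℕ, ∀ D : ℕ, D₁ ≤ D →
      ∑ d₁ ∈ Finset.Ico 1 (Skeleton.Nsupp D), ∑ d₂ ∈ Finset.Ico 1 (Skeleton.Nsupp D),
        ∑ k ∈ Finset.Ico 1 (Skeleton.Nsupp D),
          G D d₁ d₂ k / ((d₁ : ℝ) * d₂ * (Nat.totient k : ℝ)) ≤ C₀ * Skeleton.ell D ^ K)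
    (h47 : Step7u047 c')
    (hbound : ∃ c : ℝ, 0 < c ∧ ∃ C : ℝ, Skeleton.ForAllLarge fun D _ χ =>
      Skeleton.AssumptionA D χ → ∀ p ∈ Skeleton.primeWindow D, ∀ d₁ d₂ k l₂ : ℕ,
        0 < d₁ → 0 < d₂ → 0 < k → 0 < l₂ →
        ((d₂ * l₂ : ℕ) : ℝ) < Skeleton.bigP D / Skeleton.bigT D ^ 2 →
        ((d₁ * d₂ * k : ℕ) : ℝ) < Skeleton.bigP D / Skeleton.bigT D ^ 2 →
          ‖contour719 D (fun s =>
              (((l₂ : ℝ) / ((p : ℝ) * k) : ℝ) : ℂ) ^ (-s) *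
                (Skeleton.kappaTilde c' D d₁ (d₂ * k) s * Skeleton.lam c' D (d₁ * d₂ * k) s *
                  resFn c' D s))‖ ≤ C * G D d₁ d₂ k * ((p : ℝ) * k * eps1 c D / l₂)) :
    Skeleton.Prop71 c' :=
  Section7bStatements.prop71_of_leaves c' h76 h1944
    (eq710_of_contour_weighted c' G hG hsum h47 hbound) h711

/-- **(7.10) from the printed (uniform) contour bound ALONE**: `eq710_of_contour` with the
contour-shift identity §7.u047/u048 supplied by the theorem `step7u047_holds`
(`Section7ContourShift`). [cite: Zhang2022LandauSiegel, §7 pp.40–42, tex L2108–L2177] -/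
theorem eq710_of_contourBound (c' : ℝ)
    (hbound : ∃ c : ℝ, 0 < c ∧ ∃ C : ℝ, Skeleton.ForAllLarge fun D _ χ =>
      Skeleton.AssumptionA D χ → ∀ p ∈ Skeleton.primeWindow D, ∀ d₁ d₂ k l₂ : ℕ,
        0 < d₁ → 0 < d₂ → 0 < k → 0 < l₂ →
        ((d₂ * l₂ : ℕ) : ℝ) < Skeleton.bigP D / Skeleton.bigT D ^ 2 →
        ((d₁ * d₂ * k : ℕ) : ℝ) < Skeleton.bigP D / Skeleton.bigT D ^ 2 →
          ‖contour719 D (fun s =>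
              (((l₂ : ℝ) / ((p : ℝ) * k) : ℝ) : ℂ) ^ (-s) *
                (Skeleton.kappaTilde c' D d₁ (d₂ * k) s * Skeleton.lam c' D (d₁ * d₂ * k) s *
                  resFn c' D s))‖ ≤ C * ((p : ℝ) * k * eps1 c D / l₂)) :
    Section7bStatements.Eq710 c' :=
  eq710_of_contour c' (step7u047_holds c') hbound

/-- **(7.10) from a weighted contour bound and the weight's average ALONE** (`G ≥ 0` arbitrary):
`eq710_of_contour_weighted` with §7.u047 supplied by `step7u047_holds`.
[cite: Zhang2022LandauSiegel, §7 pp.40–42, tex L2108–L2177] -/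
theorem eq710_of_contourBound_weighted (c' : ℝ) (G : ℕ → ℕ → ℕ → ℕ → ℝ)
    (hG : ∀ D d₁ d₂ k, 0 ≤ G D d₁ d₂ k)
    (hsum : ∃ K : ℕ, ∃ C₀ : ℝ, ∃ D₁ : ℕ, ∀ D : ℕ, D₁ ≤ D →
      ∑ d₁ ∈ Finset.Ico 1 (Skeleton.Nsupp D), ∑ d₂ ∈ Finset.Ico 1 (Skeleton.Nsupp D),
        ∑ k ∈ Finset.Ico 1 (Skeleton.Nsupp D),
          G D d₁ d₂ k / ((d₁ : ℝ) * d₂ * (Nat.totient k : ℝ)) ≤ C₀ * Skeleton.ell D ^ K)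
    (hbound : ∃ c : ℝ, 0 < c ∧ ∃ C : ℝ, Skeleton.ForAllLarge fun D _ χ =>
      Skeleton.AssumptionA D χ → ∀ p ∈ Skeleton.primeWindow D, ∀ d₁ d₂ k l₂ : ℕ,
        0 < d₁ → 0 < d₂ → 0 < k → 0 < l₂ →
        ((d₂ * l₂ : ℕ) : ℝ) < Skeleton.bigP D / Skeleton.bigT D ^ 2 →
        ((d₁ * d₂ * k : ℕ) : ℝ) < Skeleton.bigP D / Skeleton.bigT D ^ 2 →
          ‖contour719 D (fun s =>
              (((l₂ : ℝ) / ((p : ℝ) * k) : ℝ) : ℂ) ^ (-s) *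
                (Skeleton.kappaTilde c' D d₁ (d₂ * k) s * Skeleton.lam c' D (d₁ * d₂ * k) s *
                  resFn c' D s))‖ ≤ C * G D d₁ d₂ k * ((p : ℝ) * k * eps1 c D / l₂)) :
    Section7bStatements.Eq710 c' :=
  eq710_of_contour_weighted c' G hG hsum (step7u047_holds c') hbound

/-- **(7.10) from the `G₀`-weighted contour bound ALONE** — the decl-wanted `ContourW[G₀]` of
gap row G-d24-1, `G₀(D,d₁,d₂,k) = τ₅(d₁)∏_{q∣d₁d₂k}(1 + 200q^{−9/10})²` being the weight that the
manuscript's `κ̃`/`λ` bounds (§7.u046, `step7u046_holds`, `c = 200`) deliver and whose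
(7.18)-average is polylogarithmic (`weightSum_tauFive_le`): `eq710b_of_eq720` after
`eq720_of_step7u047_of_weighted_contour_bound` (`Section7WeightSummability`) with §7.u047 fed by
`step7u047_holds`. This is the closing composition of the leaf `h710 : Eq710 c′`.
[cite: Zhang2022LandauSiegel, §7 pp.40–42, tex L2108–L2177] -/
theorem eq710_of_contourBoundG0 (c' : ℝ)
    (hbound : ∃ c : ℝ, 0 < c ∧ ∃ C : ℝ, Skeleton.ForAllLarge fun D _ χ =>
      Skeleton.AssumptionA D χ → ∀ p ∈ Skeleton.primeWindow D, ∀ d₁ d₂ k l₂ : ℕ,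
        0 < d₁ → 0 < d₂ → 0 < k → 0 < l₂ →
        ((d₂ * l₂ : ℕ) : ℝ) < Skeleton.bigP D / Skeleton.bigT D ^ 2 →
        ((d₁ * d₂ * k : ℕ) : ℝ) < Skeleton.bigP D / Skeleton.bigT D ^ 2 →
          ‖contour719 D (fun s =>
              (((l₂ : ℝ) / ((p : ℝ) * k) : ℝ) : ℂ) ^ (-s) *
                (Skeleton.kappaTilde c' D d₁ (d₂ * k) s * Skeleton.lam c' D (d₁ * d₂ * k) s *
                  resFn c' D s))‖ ≤
            C * ((tauFive d₁ : ℝ) * ∏ q ∈ (d₁ * d₂ * k).primeFactors,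
                (1 + 200 / (q : ℝ) ^ (9 / 10 : ℝ)) ^ 2) * ((p : ℝ) * k * eps1 c D / l₂)) :
    Section7bStatements.Eq710 c' :=
  eq710b_of_eq720 c'
    (eq720_of_step7u047_of_weighted_contour_bound c' (step7u047_holds c') hbound)

/-- **Proposition 7.1 from (7.6), (7.7)′, (7.11) and the `G₀`-weighted contour bound** — the
four kernel leaves of `Skeleton.Prop71 c′` at this point of the campaign (every other displayed step
of §7 pp. 32–42 being a tree theorem or one of these): `Section7bStatements.prop71_of_leaves` with
`h710` fed by `eq710_of_contourBoundG0`. [cite: Zhang2022LandauSiegel, §7 pp.32–42, tex L1786–L2178] -/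
theorem prop71_of_leaves_contourBoundG0 (c' : ℝ) (h76 : Section7bStatements.Eq76 c')
    (h1944 : Section7bStatements.Step7t1944 c') (h711 : Section7bStatements.Eq711 c')
    (hbound : ∃ c : ℝ, 0 < c ∧ ∃ C : ℝ, Skeleton.ForAllLarge fun D _ χ =>
      Skeleton.AssumptionA D χ → ∀ p ∈ Skeleton.primeWindow D, ∀ d₁ d₂ k l₂ : ℕ,
        0 < d₁ → 0 < d₂ → 0 < k → 0 < l₂ →
        ((d₂ * l₂ : ℕ) : ℝ) < Skeleton.bigP D / Skeleton.bigT D ^ 2 →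
        ((d₁ * d₂ * k : ℕ) : ℝ) < Skeleton.bigP D / Skeleton.bigT D ^ 2 →
          ‖contour719 D (fun s =>
              (((l₂ : ℝ) / ((p : ℝ) * k) : ℝ) : ℂ) ^ (-s) *
                (Skeleton.kappaTilde c' D d₁ (d₂ * k) s * Skeleton.lam c' D (d₁ * d₂ * k) s *
                  resFn c' D s))‖ ≤
            C * ((tauFive d₁ : ℝ) * ∏ q ∈ (d₁ * d₂ * k).primeFactors,
                (1 + 200 / (q : ℝ) ^ (9 / 10 : ℝ)) ^ 2) * ((p : ℝ) * k * eps1 c D / l₂)) :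
    Skeleton.Prop71 c' :=
  Section7bStatements.prop71_of_leaves c' h76 h1944 (eq710_of_contourBoundG0 c' hbound) h711

/-- The same as a refinement of the skeleton's proof node: `Skeleton.Ded71 c′` from the four
leaves (its banked hypotheses `Prop21 … Lemma56` are then unused for the last step).
[cite: Zhang2022LandauSiegel, §7 pp.32–42, tex L1786–L2178] -/
theorem ded71_of_leaves_contourBoundG0 (c' : ℝ) (h76 : Section7bStatements.Eq76 c')
    (h1944 : Section7bStatements.Step7t1944 c') (h711 : Section7bStatements.Eq711 c')
    (hbound : ∃ c : ℝ, 0 < c ∧ ∃ C : ℝ, Skeleton.ForAllLarge fun D _ χ =>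
      Skeleton.AssumptionA D χ → ∀ p ∈ Skeleton.primeWindow D, ∀ d₁ d₂ k l₂ : ℕ,
        0 < d₁ → 0 < d₂ → 0 < k → 0 < l₂ →
        ((d₂ * l₂ : ℕ) : ℝ) < Skeleton.bigP D / Skeleton.bigT D ^ 2 →
        ((d₁ * d₂ * k : ℕ) : ℝ) < Skeleton.bigP D / Skeleton.bigT D ^ 2 →
          ‖contour719 D (fun s =>
              (((l₂ : ℝ) / ((p : ℝ) * k) : ℝ) : ℂ) ^ (-s) *
                (Skeleton.kappaTilde c' D d₁ (d₂ * k) s * Skeleton.lam c' D (d₁ * d₂ * k) s *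
                  resFn c' D s))‖ ≤
            C * ((tauFive d₁ : ℝ) * ∏ q ∈ (d₁ * d₂ * k).primeFactors,
                (1 + 200 / (q : ℝ) ^ (9 / 10 : ℝ)) ^ 2) * ((p : ℝ) * k * eps1 c D / l₂)) :
    Skeleton.Ded71 c' :=
  Section7bStatements.ded71_of_leaves c' h76 h1944 (eq710_of_contourBoundG0 c' hbound) h711

end Literature.NumberTheory.LFunctions.Zhang2022.Section7dStatements
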